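/-
Copyright (c) 2026 the pub-hodgecm-mathlib formalisation cell (harness21).  Prover seat hodgecm-mathlib-K2Liu-p05 (g5), Track B «K2-LIT»,
#184♮ = hLiu418 = `stmt-HodgeConjecture-24832`; #42S payer road, organ S1 (local Siegel–Weil spanning), ROAD W file F4b
(LEAD F0P6-plan (g14) RULING «M-158a» (5) «F4a then F4b», 12:11:39Z «then F4b as queued»; SPEC-S1-AssemblySocket (K2Liu-p06 (g4)) §2 rows `hf₀inv`∕`hf₀out`∕`hsum`).
-/
import Summits.HodgeConjecture.HodgeConjecture.Theorems.K2LiuLocalSWBigCellFormula          -- ★ F4a part 2: the big-cell value (generic doubled datum)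
import Summits.HodgeConjecture.HodgeConjecture.Theorems.K2LiuLocalSWTensorAdaptedBlocks      -- ★ F5c-A: `matA_tensorEmbLoc`, `gramS_tensor`, Kronecker plumbing
import Summits.HodgeConjecture.HodgeConjecture.Theorems.K2LiuSiegelUnipotentPairingGram      -- ★ (T3a): `adapt_matA_tensorEmbLoc_nElem`
import HarnessLib

/-!
# Crux `HLiu418`, #42S organ S1, ROAD W, file F4b: THE TENSOR LETTERS OF THE BIG CELL — `w_Δ ⊗ 1 = w_Δ′`, `n(t) ⊗ 1 = n(t ⊗ 1)` —
# AND THE BIG-CELL PROFILE OF THE S1 FACE's SECTION `f₀ = F_Φ^{V′}` ALONG `tensorEmbLoc`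

Cell `hodgecm-mathlib`, crux item hLiu418 = `stmt-HodgeConjecture-24832`; squad K2 ∕ K2Liu; LEAD F0P6-plan (g14), organ lead K2Liu-p06 (g4);
prover K2Liu-p05 (g5).  THEOREMS ONLY (no `def`, no instance, no notation, no named-fact hypothesis, no `sorry`); lane
`--supports stmt-HodgeConjecture-24832 --as helper`.

WHY.  The S1 assembly socket ★ F3d-CM `localDegPS_le_of_witness` (SPEC-S1-AssemblySocket §1) reads the witness `f₀ : H_v → ℂ` ON THE SMALL GROUP
`H_v = U(𝔻)(L⁺_v)` through `f₀ (weylDelta_small · u)`, `u ∈ N_Δ(small)`, while the witness of record is a Siegel–Weil section of the auxiliary space `V′`,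
`f₀ = swSectionTensorLoc v s m₀ Φ = (h ↦ swSectionLoc v s m₀ Φ (h ⊗ 1_{V′}))` (★ D-A v1), whose big-cell value ★ F4a computes ON THE BIG GROUP `U(𝔻 ⊗ V′)(L⁺_v)` at
`weylDelta_big · n_big(t′)`.  This file supplies the two GROUP-ELEMENT letters that dock the one to the other and the docked profile:
* §0 `skew_reindex_kronecker_one` — `t ⊗ 1` is skew for `𝕋₀′ = reindex epsV (𝕋₀ ⊗ₖ 𝕋_{V′})` when `t` is skew for `𝕋₀` (★ F5c-A `gramS_tensor`).
* §1 **`tensorEmbLoc_weylDelta : (w_Δ) ⊗ 1 = w_Δ′`** (★ `matA_weylDelta` twice, ★ `matA_tensorEmbLoc`, ★ `reindex_fromBlocks_kronecker`, ★ `matA_injective`).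
* §2 **`tensorEmbLoc_nElem : n(t) ⊗ 1 = n′(reindex epsV (t ⊗ₖ 1))`** (★ (T3a) `adapt_matA_tensorEmbLoc_nElem`, ★ `adapt_matA_nElem`, ★ `eq_of_adapt_eq`), and the product
  `tensorEmbLoc_weylDelta_mul_nElem`.
* §3 **`exists_ne_zero_swSectionTensorLoc_weylDelta_mul_nElem_eq_integral_cm`** — THE BIG-CELL PROFILE OF `f₀` for Kudla's CM datum of the big group and ANY outer
  `m₀` over a mover: `∃ E′ Γ γ′ ≠ 0, ∀ t ht Φ, f₀(w_Δ · n(t)) = γ′ · ∫ ψ_v(−½ ⟨x, c_{n′(t⊗1)} x⟩) (Γ Φ)(x) dx` (★ F4a `…_integral_cm` at `t′ = t ⊗ 1`); the phase is the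
  TRACE FORM of ★ (T3a) `dotProduct_cOfFix_tensorEmbLoc_nElem_eq_im_trace` after `§2.symm` — the input of the rows `hf₀inv` (conductor of `ψ_v ∘ tr`), `hf₀out`
  (oscillation) and `hsum` (the count) of SPEC-S1 §2.
References: [Kudla1994] §2–§3, Thm. 3.1; [HarrisKudlaSweet1996] §1 (1.11), (1.15)–(1.16); [MoeglinVignerasWaldspurger1987] Chap. 1 I.17, Chap. 2 II.6;
[Rangarao1993] §3.1 (3.9), Lemma 3.2 p. 351; [Weil1964] n° 13, n° 32; [KudlaRallis1994] §1.
HONEST LABEL.  Count-neutral helper: `HC_CM` is proved only modulo the 7 printed citations (2 remaining named inputs: hLiu418 = `stmt-HodgeConjecture-24832`,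
h413 = `stmt-HodgeConjecture-24833`) until rung 0 closes.
-/

set_option autoImplicit false
set_option linter.dupNamespace false -- the mandated namespace repeats `HodgeConjecture.HodgeConjecture`

noncomputable section

open scoped Matrix Kronecker
open NumberField IsDedekindDomain MeasureTheory MeasureTheory.Measure Matrix
open Literature.RepresentationTheory.HeisenbergGroup Literature.RepresentationTheory.HeisenbergGroup.SymplecticMatrix
open Literature.NumberTheory.Automorphic Literature.NumberTheory.Automorphic.UnitaryGroup Literature.NumberTheory.Weil1964
open Literature.NumberTheory.GaloisRepresentations Literature.NumberTheory.GaloisRepresentations.IsNonarchimedeanLocalField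
open Literature.RepresentationTheory.HarrisKudlaSweet1996
open Literature.NumberTheory.GelbartRogawski1991 Literature.NumberTheory.GelbartRogawski1991.GRConstruction
open Literature.NumberTheory.GelbartRogawski1991.UnitaryDualPair
open Literature.NumberTheory.GelbartRogawski1991.UnitaryDualPair.LocalSplitting
open Literature.NumberTheory.GelbartRogawski1991.AdaptedBlocks
open Literature.NumberTheory.K2Lit.SiegelDoubled
open Summit.HodgeConjecture.HodgeConjecture.Cruxes.HLiu418.K2LiuLocalSWSectionDefs
open Summit.HodgeConjecture.HodgeConjecture.Cruxes.HLiu418.K2LiuLocalSWTensorAdaptedBlocks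
open Summit.HodgeConjecture.HodgeConjecture.Cruxes.HLiu418.K2LiuSiegelUnipotentPairingGram
open Summit.HodgeConjecture.HodgeConjecture.Cruxes.HLiu418.K2LiuLocalSWBigCellFormula

namespace Summit.HodgeConjecture.HodgeConjecture.Cruxes.HLiu418.K2LiuLocalSWTensorBigCellLetters

variable (L : Type) [Field L] [NumberField L] [IsCMField L]
variable {N M n : ℕ} (e : Fin N × Fin M ≃ Fin n)
  (dV : Fin N → L) (hdV : ∀ i, IsCMField.complexConj L (dV i) = dV i)
  (dW : Fin M → L) (hdW : ∀ i, IsCMField.complexConj L (dW i) = dW i)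
variable {M₂ M' n' : ℕ} (eW : Fin M × Fin M₂ ≃ Fin M') (e' : Fin N × Fin M' ≃ Fin n')
  (dV' : Fin M₂ → L) (hdV' : ∀ k, IsCMField.complexConj L (dV' k) = dV' k)
variable (v : HeightOneSpectrum (𝓞 (Fp L)))

/-! ## §0 `t ⊗ 1` is skew for the tensor Gram matrix -/

/-- **`t ⊗ 1` IS SKEW FOR `𝕋₀′ = reindex epsV (𝕋₀ ⊗ₖ 𝕋_{V′})`** when `t` is skew for `𝕋₀` (`(t ⊗ 1)* (𝕋₀ ⊗ D) + (𝕋₀ ⊗ D)(t ⊗ 1) = (t* 𝕋₀ + 𝕋₀ t) ⊗ D = 0`;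
★ F5c-A `gramS_tensor`, `cstar_reindex_kronecker_one`, `reindex_kronecker_mul`, `reindex_kronecker_linear`). [cite: Kudla1994, §3] [cite: HarrisKudlaSweet1996, §1 (1.11)] -/
theorem skew_reindex_kronecker_one (t : Matrix (Fin n) (Fin n) (LocalRing L v))
    (ht : (t.map (conjLocal L (IsCMField.complexConj L) v))ᵀ * gramS (Fp L) L v n (gramR L e dV hdV dW hdW) +
      gramS (Fp L) L v n (gramR L e dV hdV dW hdW) * t = 0) :
    ((Matrix.reindex (epsV e eW e') (epsV e eW e') (t ⊗ₖ (1 : Matrix (Fin M₂) (Fin M₂) (LocalRing L v)))).map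
          (conjLocal L (IsCMField.complexConj L) v))ᵀ *
        gramS (Fp L) L v n' (gramR L e' dV hdV (tensorFrame L dW eW dV') (tensorFrame_real L dW hdW eW dV' hdV')) +
      gramS (Fp L) L v n' (gramR L e' dV hdV (tensorFrame L dW eW dV') (tensorFrame_real L dW hdW eW dV' hdV')) *
        Matrix.reindex (epsV e eW e') (epsV e eW e') (t ⊗ₖ (1 : Matrix (Fin M₂) (Fin M₂) (LocalRing L v))) = 0 := by
  rw [gramS_tensor L e dV hdV dW hdW eW e' dV' hdV' v, cstar_reindex_kronecker_one, reindex_kronecker_mul, reindex_kronecker_mul,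
    Matrix.one_mul, Matrix.mul_one, ← (reindex_kronecker_linear (epsV e eW e') _ _ _ (1 : LocalRing L v)).1, ht, Matrix.zero_kronecker]
  simp only [Matrix.reindex_apply, Matrix.submatrix_zero, Pi.zero_apply]

/-! ## §1 `w_Δ ⊗ 1 = w_Δ′` -/

/-- **THE WEYL LETTER**: `tensorEmbLoc v (w_Δ) = w_Δ′` — the matrix of `w_Δ` over `L ⊗ L⁺_v` is `1 ⊕ (−1)` on BOTH groups (★ `matA_weylDelta`), and
`reindex (eΣ epsV) ((1 ⊕ (−1)) ⊗ₖ 1) = 1 ⊕ (−1)` (★ `matA_tensorEmbLoc`, ★ `reindex_fromBlocks_kronecker`); conclude by ★ `matA_injective`.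
[cite: Kudla1994, §3] [cite: MoeglinVignerasWaldspurger1987, Chap. 1 I.17] [cite: Weil1964, n° 32] -/
theorem tensorEmbLoc_weylDelta :
    tensorEmbLoc L e dV hdV dW hdW eW e' dV' hdV' v
        (weylDelta (Fp L) L (IsCMField.complexConj L) v n (T₀ := gramR L e dV hdV dW hdW) (hermD_eq_map_gramD L e dV hdV dW hdW)) =
      weylDelta (Fp L) L (IsCMField.complexConj L) v n'
        (T₀ := gramR L e' dV hdV (tensorFrame L dW eW dV') (tensorFrame_real L dW hdW eW dV' hdV'))
        (hermD_eq_map_gramD L e' dV hdV (tensorFrame L dW eW dV') (tensorFrame_real L dW hdW eW dV' hdV')) := by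
  apply matA_injective (Fp L) L (IsCMField.complexConj L) v n'
  rw [matA_tensorEmbLoc, matA_weylDelta, matA_weylDelta, reindex_fromBlocks_kronecker]
  have h1 : Matrix.reindex (epsV e eW e') (epsV e eW e')
      ((1 : Matrix (Fin n) (Fin n) (LocalRing L v)) ⊗ₖ (1 : Matrix (Fin M₂) (Fin M₂) (LocalRing L v))) = 1 := by
    rw [Matrix.one_kronecker_one, Matrix.reindex_apply, Matrix.submatrix_one_equiv]
  have h0 : Matrix.reindex (epsV e eW e') (epsV e eW e')
      ((0 : Matrix (Fin n) (Fin n) (LocalRing L v)) ⊗ₖ (1 : Matrix (Fin M₂) (Fin M₂) (LocalRing L v))) = 0 := by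
    rw [Matrix.zero_kronecker, Matrix.reindex_apply, Matrix.submatrix_zero]; rfl
  have hn : Matrix.reindex (epsV e eW e') (epsV e eW e')
      ((-1 : Matrix (Fin n) (Fin n) (LocalRing L v)) ⊗ₖ (1 : Matrix (Fin M₂) (Fin M₂) (LocalRing L v))) = -1 := by
    rw [show (-1 : Matrix (Fin n) (Fin n) (LocalRing L v)) = 0 - 1 from (zero_sub 1).symm,
      (reindex_kronecker_linear (epsV e eW e') (0 : Matrix (Fin n) (Fin n) (LocalRing L v)) 1 (1 : Matrix (Fin M₂) (Fin M₂) (LocalRing L v))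
        (1 : LocalRing L v)).2.1, h0, h1, zero_sub]
  rw [h1, h0, hn]

/-! ## §2 `n(t) ⊗ 1 = n′(t ⊗ 1)` and the product -/

/-- **THE UNIPOTENT LETTER**: `tensorEmbLoc v (n(t)) = n′(reindex epsV (t ⊗ₖ 1))` — both sides have adapted matrix `[[1, t ⊗ 1], [0, 1]]` (★ (T3a)
`adapt_matA_tensorEmbLoc_nElem`, ★ `adapt_matA_nElem`), and `adapt ∘ matA` is injective (★ `eq_of_adapt_eq`, ★ `matA_injective`).
[cite: Kudla1994, §3] [cite: MoeglinVignerasWaldspurger1987, Chap. 1 I.17] [cite: Weil1964, n° 32] -/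
theorem tensorEmbLoc_nElem (t : Matrix (Fin n) (Fin n) (LocalRing L v))
    (ht : (t.map (conjLocal L (IsCMField.complexConj L) v))ᵀ * gramS (Fp L) L v n (gramR L e dV hdV dW hdW) +
      gramS (Fp L) L v n (gramR L e dV hdV dW hdW) * t = 0) :
    tensorEmbLoc L e dV hdV dW hdW eW e' dV' hdV' v
        (nElem (Fp L) L (IsCMField.complexConj L) v n (T₀ := gramR L e dV hdV dW hdW) (hermD_eq_map_gramD L e dV hdV dW hdW) t ht) =
      nElem (Fp L) L (IsCMField.complexConj L) v n'
        (T₀ := gramR L e' dV hdV (tensorFrame L dW eW dV') (tensorFrame_real L dW hdW eW dV' hdV'))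
        (hermD_eq_map_gramD L e' dV hdV (tensorFrame L dW eW dV') (tensorFrame_real L dW hdW eW dV' hdV'))
        (Matrix.reindex (epsV e eW e') (epsV e eW e') (t ⊗ₖ (1 : Matrix (Fin M₂) (Fin M₂) (LocalRing L v))))
        (skew_reindex_kronecker_one L e dV hdV dW hdW eW e' dV' hdV' v t ht) := by
  apply matA_injective (Fp L) L (IsCMField.complexConj L) v n'
  apply eq_of_adapt_eq
  rw [adapt_matA_tensorEmbLoc_nElem, adapt_matA_nElem]

set_option maxHeartbeats 800000 in -- the two `localPi` telescopes (as ★ F5c-A)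
/-- **the big-cell word**: `tensorEmbLoc v (w_Δ · n(t)) = w_Δ′ · n′(reindex epsV (t ⊗ₖ 1))` (§1, §2, multiplicativity).
[cite: Kudla1994, §3] [cite: MoeglinVignerasWaldspurger1987, Chap. 1 I.17] -/
theorem tensorEmbLoc_weylDelta_mul_nElem (t : Matrix (Fin n) (Fin n) (LocalRing L v))
    (ht : (t.map (conjLocal L (IsCMField.complexConj L) v))ᵀ * gramS (Fp L) L v n (gramR L e dV hdV dW hdW) +
      gramS (Fp L) L v n (gramR L e dV hdV dW hdW) * t = 0) :
    tensorEmbLoc L e dV hdV dW hdW eW e' dV' hdV' v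
        (weylDelta (Fp L) L (IsCMField.complexConj L) v n (T₀ := gramR L e dV hdV dW hdW) (hermD_eq_map_gramD L e dV hdV dW hdW) *
          nElem (Fp L) L (IsCMField.complexConj L) v n (T₀ := gramR L e dV hdV dW hdW) (hermD_eq_map_gramD L e dV hdV dW hdW) t ht) =
      weylDelta (Fp L) L (IsCMField.complexConj L) v n'
          (T₀ := gramR L e' dV hdV (tensorFrame L dW eW dV') (tensorFrame_real L dW hdW eW dV' hdV'))
          (hermD_eq_map_gramD L e' dV hdV (tensorFrame L dW eW dV') (tensorFrame_real L dW hdW eW dV' hdV')) *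
        nElem (Fp L) L (IsCMField.complexConj L) v n'
          (T₀ := gramR L e' dV hdV (tensorFrame L dW eW dV') (tensorFrame_real L dW hdW eW dV' hdV'))
          (hermD_eq_map_gramD L e' dV hdV (tensorFrame L dW eW dV') (tensorFrame_real L dW hdW eW dV' hdV'))
          (Matrix.reindex (epsV e eW e') (epsV e eW e') (t ⊗ₖ (1 : Matrix (Fin M₂) (Fin M₂) (LocalRing L v))))
          (skew_reindex_kronecker_one L e dV hdV dW hdW eW e' dV' hdV' v t ht) := by
  rw [map_mul]
  exact congrArg₂ (· * ·) (tensorEmbLoc_weylDelta L e dV hdV dW hdW eW e' dV' hdV' v) (tensorEmbLoc_nElem L e dV hdV dW hdW eW e' dV' hdV' v t ht)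

/-! ## §3 The big-cell profile of the S1 face's section -/

section Profile

variable [MeasurableSpace (v.adicCompletion (Fp L))] [BorelSpace (v.adicCompletion (Fp L))]
  (μ : Measure (v.adicCompletion (Fp L))) [μ.IsAddHaarMeasure]
  (hdV0 : ∀ i, dV i ≠ 0) (hdW0 : ∀ i, dW i ≠ 0) (hdV'0 : ∀ k, dV' k ≠ 0)

set_option maxHeartbeats 4000000 in -- the doubled CM datum's telescope at the tensor frame (as ★ F4a)
/-- **THE BIG-CELL PROFILE OF `f₀ = F_Φ^{V′}` ON THE SMALL GROUP.**  For Kudla's CM splitting `s′ = s^𝔻_{𝕋₀′}` of the big group `U(𝔻 ⊗ V′)(L⁺_v)` (★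
`localSplittingDatumCM` at `n′`, `𝕋₀′ = gramR e′ dV (tensorFrame dW eW dV′)`) and ANY outer implementer `m₀ ∈ S̃p_ψ` over a mover of `ℓ_Δ′` onto `ℓ_Y′` (`hm₀`; the
`m₀` of record qualifies), there are a Cayley mover `E′`, its transport implementer `Γ` and ONE scalar `γ′ ≠ 0` with, for every `𝕋₀`-skew `t` and every `Φ`,
`swSectionTensorLoc v s′ m₀ Φ (w_Δ · n(t)) = γ′ · ∫ ψ_v(−½ ⟨x, c x⟩) · (Γ Φ)(x) dμ^{⊗(n′+n′)}(x)`, `c = cOfFix 𝕋′ (E′ ι′(n′(reindex epsV (t ⊗ₖ 1))) E′⁻¹)` —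
★ F4a `exists_ne_zero_swSectionLoc_weylDelta_mul_nElem_eq_integral_cm` on the big group at `t′ = t ⊗ 1`, docked by §2 `tensorEmbLoc_weylDelta_mul_nElem`.  The phase is
★ (T3a)'s trace form after `tensorEmbLoc_nElem`. [cite: Kudla1994, §3 Thm. 3.1] [cite: Rangarao1993, §3.1 (3.9), Lemma 3.2 p. 351] [cite: Weil1964, n° 13, n° 32]
[cite: MoeglinVignerasWaldspurger1987, Chap. 2 II.6] [cite: HarrisKudlaSweet1996, §1 (1.15)–(1.16)] -/
theorem exists_ne_zero_swSectionTensorLoc_weylDelta_mul_nElem_eq_integral_cm (χ : HeckeCharacter L) (hχ : IsSplittingChar L 1 χ)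
    (m₀ : LocalMp (Fp L) (n' + n') (gramD (Fp L) n' (gramR L e' dV hdV (tensorFrame L dW eW dV') (tensorFrame_real L dW hdW eW dV' hdV'))) v)
    (hm₀ : (deltaLagrangian (Fp L) v n').map (toLin (Fp L) v (MpPsi.proj _ m₀)) = lagrangianY (Fp L) (n' + n') v)
    {m : ℤ} (hm : (adeleAddCharAt (Fp L) v).HasConductorExp m) :
    ∃ (E' : LocalSp (Fp L) (n' + n') (gramD (Fp L) n' (gramR L e' dV hdV (tensorFrame L dW eW dV') (tensorFrame_real L dW hdW eW dV' hdV'))) v)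
      (Γ : SchwartzBruhat (Fin (n' + n') → v.adicCompletion (Fp L)) ≃ₗ[ℂ] SchwartzBruhat (Fin (n' + n') → v.adicCompletion (Fp L))) (γ' : ℂ),
      (deltaLagrangian (Fp L) v n').map (toLin (Fp L) v E') = lagrangianY (Fp L) (n' + n') v ∧
      Implements (localSchrodinger (Fp L) (n' + n')
        (gramD (Fp L) n' (gramR L e' dV hdV (tensorFrame L dW eW dV') (tensorFrame_real L dW hdW eW dV' hdV'))) v) (ofSymplectic _ E') Γ ∧ γ' ≠ 0 ∧
      ∀ (t : Matrix (Fin n) (Fin n) (LocalRing L v))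
        (ht : (t.map (conjLocal L (IsCMField.complexConj L) v))ᵀ * gramS (Fp L) L v n (gramR L e dV hdV dW hdW) +
          gramS (Fp L) L v n (gramR L e dV hdV dW hdW) * t = 0)
        (Φ : SchwartzBruhat (Fin (n' + n') → v.adicCompletion (Fp L))),
        swSectionTensorLoc L e dV hdV dW hdW eW e' dV' hdV' v
            (localSplittingDatumCM L v μ n' (gramR_isSymm L e' dV hdV (tensorFrame L dW eW dV') (tensorFrame_real L dW hdW eW dV' hdV'))
              (isUnit_det_gramR₀ L e' dV hdV hdV0 (tensorFrame L dW eW dV') (tensorFrame_real L dW hdW eW dV' hdV')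
                (tensorFrame_ne_zero L dW eW dV' hdW0 hdV'0))
              (hermD_eq_map_gramD L e' dV hdV (tensorFrame L dW eW dV') (tensorFrame_real L dW hdW eW dV' hdV')) χ hχ).localSplitting
            m₀ Φ
            (weylDelta (Fp L) L (IsCMField.complexConj L) v n (T₀ := gramR L e dV hdV dW hdW) (hermD_eq_map_gramD L e dV hdV dW hdW) *
              nElem (Fp L) L (IsCMField.complexConj L) v n (T₀ := gramR L e dV hdV dW hdW) (hermD_eq_map_gramD L e dV hdV dW hdW) t ht) =
          γ' * ∫ x : Fin (n' + n') → v.adicCompletion (Fp L),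
            ((adeleAddCharAt (Fp L) v
                (-(⅟(2 : v.adicCompletion (Fp L)) *
                  (x ⬝ᵥ (cOfFix (localGram (Fp L) (n' + n')
                      (gramD (Fp L) n' (gramR L e' dV hdV (tensorFrame L dW eW dV') (tensorFrame_real L dW hdW eW dV' hdV'))) v)
                    (E' * iotaD (Fp L) L (IsCMField.complexConj L) (complexConj_imagUnit L) (imagUnit_ne_zero L) (imagUnit_mul_self L) v n'
                        (gramR_isSymm L e' dV hdV (tensorFrame L dW eW dV') (tensorFrame_real L dW hdW eW dV' hdV'))
                        (hermD_eq_map_gramD L e' dV hdV (tensorFrame L dW eW dV') (tensorFrame_real L dW hdW eW dV' hdV'))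
                        (nElem (Fp L) L (IsCMField.complexConj L) v n'
                          (T₀ := gramR L e' dV hdV (tensorFrame L dW eW dV') (tensorFrame_real L dW hdW eW dV' hdV'))
                          (hermD_eq_map_gramD L e' dV hdV (tensorFrame L dW eW dV') (tensorFrame_real L dW hdW eW dV' hdV'))
                          (Matrix.reindex (epsV e eW e') (epsV e eW e') (t ⊗ₖ (1 : Matrix (Fin M₂) (Fin M₂) (LocalRing L v))))
                          (skew_reindex_kronecker_one L e dV hdV dW hdW eW e' dV' hdV' v t ht)) * E'⁻¹) *ᵥ x)))) : ℂ) *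
              ((Γ Φ : SchwartzBruhat (Fin (n' + n') → v.adicCompletion (Fp L))) : (Fin (n' + n') → v.adicCompletion (Fp L)) → ℂ) x)
            ∂(Measure.pi fun _ => μ) := by
  obtain ⟨E', Γ, γ', hE', hΓ, hγ', h⟩ := exists_ne_zero_swSectionLoc_weylDelta_mul_nElem_eq_integral_cm L v μ n'
    (gramR_isSymm L e' dV hdV (tensorFrame L dW eW dV') (tensorFrame_real L dW hdW eW dV' hdV'))
    (isUnit_det_gramR₀ L e' dV hdV hdV0 (tensorFrame L dW eW dV') (tensorFrame_real L dW hdW eW dV' hdV') (tensorFrame_ne_zero L dW eW dV' hdW0 hdV'0))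
    (hermD_eq_map_gramD L e' dV hdV (tensorFrame L dW eW dV') (tensorFrame_real L dW hdW eW dV' hdV')) χ hχ m₀ hm₀ hm
  refine ⟨E', Γ, γ', hE', hΓ, hγ', fun t ht Φ => ?_⟩
  -- `f₀(w_Δ · n(t)) = F(tensorEmbLoc (w_Δ · n(t))) = F(w_Δ′ · n′(t ⊗ 1))` (§2; no `rw` on the telescope: `congrArg`), then ★ F4a at `t ⊗ 1`
  exact (congrArg (swSectionLoc L v
      (localSplittingDatumCM L v μ n' (gramR_isSymm L e' dV hdV (tensorFrame L dW eW dV') (tensorFrame_real L dW hdW eW dV' hdV'))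
        (isUnit_det_gramR₀ L e' dV hdV hdV0 (tensorFrame L dW eW dV') (tensorFrame_real L dW hdW eW dV' hdV')
          (tensorFrame_ne_zero L dW eW dV' hdW0 hdV'0))
        (hermD_eq_map_gramD L e' dV hdV (tensorFrame L dW eW dV') (tensorFrame_real L dW hdW eW dV' hdV')) χ hχ).localSplitting m₀ Φ)
    (tensorEmbLoc_weylDelta_mul_nElem L e dV hdV dW hdW eW e' dV' hdV' v t ht)).trans (h _ _ Φ)

end Profile

end Summit.HodgeConjecture.HodgeConjecture.Cruxes.HLiu418.K2LiuLocalSWTensorBigCellLetters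

end
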